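import Summits.BirchSwinnertonDyer.BirchSwinnertonDyer.Theorems.PrintCf2RubinValueTwoKatzMeasureJZeroSeamP1OfLane
import Summits.BirchSwinnertonDyer.BirchSwinnertonDyer.Theorems.PrintCf2RubinValueTwoKatzMeasureJZeroSupplyOfPerLevel
import Summits.BirchSwinnertonDyer.BirchSwinnertonDyer.Theorems.PrintCf2RubinValueTwoKatzMeasureJZeroSeamValuesOfLane
import HarnessLib

/-!
# The SEAM of the `j = 0` lane — CLOSED BY NAME modulo the de Shalit prints: `hsupply` (the registered SEAM stub
# `stub_katzSeamSupply_two` of crux 20368, skeleton v14.9) and the R3 endpoint of print leaf 24720, from II.1.5 (15), II.2.4 (i)–(iii), II.2.5 (i), II.2.7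

Cell `bsd-print-cf2`, width seat `bsd-line-cf2-p1-w3` g32; `--supports` the crux stmt-BirchSwinnertonDyer-20368 (helper, Theses-free).
THEOREMS ONLY; no `def`, no named fact, no `sorry`; CONDITIONAL on the prints `DeShalit1987.prop15_grossencharacterReciprocity`,
`prop24_i_mem_rayClassField`, `prop24_ii_galoisAction`, `prop24_iii_unit`, `prop25_i_normRelation`, `prop27_power` (named-fact hypotheses).
Pure composition BY NAME: `katzSeamSupply_two_of_perLevel` / `lMeasureJZero_classNumberOne_two_of_perLevel` (-w3 g31, p769392) ∘ the bridge
`P1_of_perUnitValues` (-w3 g32) ∘ the per-unit values `KatzMeasureJZeroSeam.perUnitValues_of_lane` ([I2], -w8) — the `τ`-unit (U♯) (-w5) and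
[I1] (-w8) being consumed inside the bridge.  Nothing here closes a crux by itself (the LEAD substitutes `katzSeamSupply_two_of_lane` for the SEAM
stub of the registered skeleton); no summit statement is proved; BSD is not proved by any of this.

References: [deShalit1987] II.4.12 (p. 66–69), II.4.14 (36)–(40) (p. 71–73), II.4.16 (49)–(50) (p. 76–77).
-/


-- the summit namespace `Summit.BirchSwinnertonDyer.BirchSwinnertonDyer` repeats the problem name by design (D-0017)
set_option linter.dupNamespace false
set_option autoImplicit false

noncomputable section

open scoped NumberField Classical nonZeroDivisors
open NumberField IsDedekindDomain Field
open IsDedekindDomain.HeightOneSpectrum ValuativeRel IsLocalRing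
open Literature Literature.NumberTheory.GaloisRepresentations Literature.NumberTheory.EllipticCurves
open Literature.NumberTheory.GaloisRepresentations.IsNonarchimedeanLocalField Literature.NumberTheory.GaloisRepresentations.LubinTate
  Literature.NumberTheory.GaloisRepresentations.ArtinLocalGlobal Literature.NumberTheory.PAdicHodge
open Literature.NumberTheory.LFunctions Literature.NumberTheory.NumberFields
open Literature.NumberTheory.EllipticCurves.GroupDistribution Literature.NumberTheory.ComplexMultiplication.EllipticUnits
open Literature.NumberTheory.LFunctions.AbelianDensity (artinSymbol)
open Literature.NumberTheory.EllipticCurves.DeShalit1987 Literature.NumberTheory.GaloisRepresentations.HeckeCharacter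
open Summit.BirchSwinnertonDyer.BirchSwinnertonDyer.Theorems.PrintCf2.EllipticUnitsLocal
  Summit.BirchSwinnertonDyer.BirchSwinnertonDyer.Theorems.PrintCf2.EllipticUnitsGlobal
  Summit.BirchSwinnertonDyer.BirchSwinnertonDyer.Theorems.PrintCf2.EllipticUnitsTwoVariable
open MvPowerSeries

namespace Summit.BirchSwinnertonDyer.BirchSwinnertonDyer.Theorems.PrintCf2.KatzMeasureJZeroTop

attribute [local instance] ltNormUniformSpace ltNormIsUniformAddGroup rk1 nF nE fintypeResidueField
attribute [local instance] RelNormCoherentUnits.instCommMonoid GlobalNormCoherentUnits.instCommMonoid GlobalNormCoherentUnits.galAction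

set_option maxHeartbeats 1600000 in
/-- ★★★ **`P1` — the registered BRIDGE stub `stub_perLevelBridge_two` of skeleton v14.10 (crux 20368) — from the prints alone**
(`P1_of_perUnitValues ∘ KatzMeasureJZeroSeam.perUnitValues_of_lane`).  GIVEN II.1.5 (15), II.2.4 (ii)(iii), II.2.5 (i).
[cite: deShalit1987, II.4.12 (31) (p. 66–69), II.4.14 (36)–(40) (p. 71–73)] -/
theorem P1_of_lane
    (h15 : DeShalit1987.prop15_grossencharacterReciprocity)
    (h24ii : DeShalit1987.prop24_ii_galoisAction) (h24iii : DeShalit1987.prop24_iii_unit) (h25 : DeShalit1987.prop25_i_normRelation) :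
    ∀ (K : Type) [Field K] [NumberField K] [IsTotallyComplex K] (hK : IsImaginaryQuadratic K) (_ : NumberField.classNumber K = 1)
      (ι : PadicAlgCl 2 ≃+* ℂ) (w₀ : InfinitePlace K) (v vbar : HeightOneSpectrum (𝓞 K))
        (hv2 : ((2 : ℕ) : 𝓞 K) ∈ v.asIdeal) (hvbar2 : ((2 : ℕ) : 𝓞 K) ∈ vbar.asIdeal) (hne : vbar ≠ v)
        (_ : ∀ (w : InfinitePlace K) (k : 𝓞 K), k ∈ v.asIdeal ↔ ‖ι.symm (w.embedding (k : K))‖ < 1) {α₀ : 𝓞 K} (hv0 : v.asIdeal = Ideal.span {α₀})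
        (hdK : NumberField.discr K = -7) (hα₀ : α₀ ^ 2 - α₀ + 2 = 0) (hw2 : ∀ uu : (𝓞 K)ˣ, (uu : 𝓞 K) - 1 ∈ vbar.asIdeal ^ 2 → uu = 1)
    (hq : residueFieldCard (v.adicCompletion K) = 2) (h2 : (valuation (v.adicCompletion K)).IsUniformizer ((((2 : ℕ) : 𝒪[v.adicCompletion K]) : v.adicCompletion K)))
    (u : 𝒪[v.adicCompletion K]ˣ)
    (hu : ((((u : 𝒪[v.adicCompletion K]) * ((2 : ℕ) : 𝒪[v.adicCompletion K]) : 𝒪[v.adicCompletion K]) : v.adicCompletion K)) = ((α₀ : K) : v.adicCompletion K))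
    {σ₀ : absoluteGaloisGroup (v.adicCompletion K)} (hσ₀ : IsAbsArithFrob σ₀) {ε : (maxUnramifiedCompletion (v.adicCompletion K))ˣ}
    (hε : maxUnramifiedCompletion.galAut (v.adicCompletion K) σ₀ (ε : maxUnramifiedCompletion (v.adicCompletion K)) =
      algebraMap 𝒪[v.adicCompletion K] (maxUnramifiedCompletion (v.adicCompletion K)) (u : 𝒪[v.adicCompletion K]) * (ε : maxUnramifiedCompletion (v.adicCompletion K)))
    (θ : CompletedAlgClosure (v.adicCompletion K) →+* ℂ_[2]) (hθ1 : ∀ z : CBall (v.adicCompletion K), ‖θ (z : CompletedAlgClosure (v.adicCompletion K))‖ ≤ 1)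
    (e₂ : v.adicCompletionIntegers K ≃+* ℤ_[2]) (hΘe : ∀ a : 𝒪[v.adicCompletion K], (θ.comp ((CBall (v.adicCompletion K)).subtype.comp
        (algebraMap (UnrCoeff (v.adicCompletion K)) (CBall (v.adicCompletion K))))) (intToUnrCoeff (v.adicCompletion K) a) =
      padicIntCast ℂ_[2] (((e₂ : v.adicCompletionIntegers K →+* ℤ_[2]).comp (integerEquivAdicCompletionIntegers v).toRingHom) a)) (_ : Continuous θ)
        (_ : ∀ ζ' : ℂ_[2], (∃ n : ℕ, ζ' ^ 2 ^ n = 1) → ∃ ζ : CompletedAlgClosure (v.adicCompletion K), (∃ n : ℕ, ζ ^ 2 ^ n = 1) ∧ θ ζ = ζ')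
        (_ : Function.Bijective θ) (_ : ∀ z : CompletedAlgClosure (v.adicCompletion K), ‖z‖ < 1 → ‖θ z‖ < 1),
      ∃ (Ω : ℂ) (Ωp : (unrIntegers 2)ˣ) (Θε : ℂ_[2]) (τ : absoluteGaloisGroup K), Ω ≠ 0 ∧ ‖Θε‖ ≤ 1 ∧ ∀ (S : Finset (HeightOneSpectrum (𝓞 K))), v ∉ S → vbar ∉ S →
      ∀ (𝔣 : ℕ → Ideal (𝓞 K)) (𝔩 : ℕ → HeightOneSpectrum (𝓞 K)) (𝔪c : ℕ → Ideal (𝓞 K)) (b : ℕ → ℕ) (_ : 𝔣 0 = (∏ w ∈ S, w.asIdeal) * vbar.asIdeal ^ 2)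
        (h𝔣succ : ∀ k, 𝔣 (k + 1) = 𝔣 k * (𝔩 k).asIdeal) (hdiv : ∀ k, (𝔩 k).asIdeal ∣ 𝔣 k) (_ : ∀ k, 𝔣 k = 𝔪c k * vbar.asIdeal ^ (b k + 1)) (_ : ∀ k, 1 ≤ b k)
        (_ : ∀ k, ¬ 𝔪c k ≤ v.asIdeal) (_ : ∀ k, ¬ 𝔪c k ≤ vbar.asIdeal) (_ : ∀ k, 𝔩 k = vbar ∨ 𝔩 k ∈ S) (_ : ∀ m : ℕ, ∃ n, 𝔣 n ≤ ((∏ w ∈ S, w.asIdeal) * vbar.asIdeal) ^ m)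
    (h𝔣0 : ∀ m : ℕ, 𝔣 m ≠ ⊥) (h𝔣1 : ∀ m : ℕ, 𝔣 m ≠ ⊤) (hvm : ∀ m : ℕ, ¬ 𝔣 m ≤ v.asIdeal) (hwm : ∀ (m : ℕ) (u : (𝓞 K)ˣ), (u : 𝓞 K) - 1 ∈ 𝔣 m → u = 1)
      (hle : ∀ m : ℕ, 𝔣 (m + 1) ≤ 𝔣 m) (α : ℕ → 𝓞 K) (hα0 : ∀ m, α m ≠ 0) (hα𝔣 : ∀ m, α m - 1 ∈ 𝔣 m) (hαw : ∀ (m : ℕ) (w : HeightOneSpectrum (𝓞 K)), w ≠ v → α m ∉ w.asIdeal)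
      (f : ℕ → ℕ) (hαπ : ∀ m, ((α m : K) : v.adicCompletion K) =
        ((((u : 𝒪[v.adicCompletion K]) * ((2 : ℕ) : 𝒪[v.adicCompletion K]) : 𝒪[v.adicCompletion K]) : v.adicCompletion K)) ^ f m)
      (E : ℕ → IntermediateField (v.adicCompletion K) (AlgebraicClosure (v.adicCompletion K)))
      (_ : ∀ m, FiniteDimensional (v.adicCompletion K) (E m)) (_ : ∀ m, IsGalois (v.adicCompletion K) (E m)) (hE : ∀ m, E m ≤ maxUnramified (v.adicCompletion K))
      (hdegE : ∀ (m : ℕ) (w : WeilGroup (v.adicCompletion K)), WeilGroup.toAbsGalois (v.adicCompletion K) w ∈ (E m).fixingSubgroup → (f m : ℤ) ∣ WeilGroup.deg w)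
      (hEE : ∀ m, E m ≤ E (m + 1)) (j : ∀ m : ℕ, unitBall (E m) →+* UnrCoeff (v.adicCompletion K))
      (_ : ∀ m, (j m).comp (algebraMap (LTCoeff (v.adicCompletion K)) (unitBall (E m))) =
        (intToUnrCoeff (v.adicCompletion K)).comp (LTCoeff.of (v.adicCompletion K)).symm.toRingHom)
      (hjC : ∀ m, (algebraMap (UnrCoeff (v.adicCompletion K)) (CBall (v.adicCompletion K))).comp (j m) = unitBallToCBall (E m))
      (_ : ∀ (m : ℕ) (y : unitBall (E m)), j (m + 1) (inclUnitBall (F := v.adicCompletion K) (hEE m) y) = j m y)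
      (ψ : ∀ m n : ℕ, ↥(absRestrictNormalHom (rayClassField K (𝔣 m))).ker ⧸ (rayAdicTower (𝔪 := 𝔣 m) (h𝔣0 m) v).U n → ZMod (2 ^ (n + 1)))
      (hψ : ∀ (m n : ℕ) (g : ↥(absRestrictNormalHom (rayClassField K (𝔣 m))).ker), g ∈ (rayAdicTower (𝔪 := 𝔣 m) (h𝔣0 m) v).U 0 →
        ψ m n ((rayAdicTower (𝔪 := 𝔣 m) (h𝔣0 m) v).proj n g) = PadicInt.toZModPow (n + 1) ((((Units.map (e₂ : v.adicCompletionIntegers K →+* ℤ_[2]).toMonoidHom).comp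
            (rayAdicCharacter (h𝔣0 m) (hvm m) (hwm m)))⁻¹ g : ℤ_[2]ˣ) : ℤ_[2])) (g : {c : Ideal (𝓞 K) // c ≠ ⊥ ∧ IsCoprime c (𝔣 0 * v.asIdeal)} → absoluteGaloisGroup K)
      (_ : ∀ (c : {c : Ideal (𝓞 K) // c ≠ ⊥ ∧ IsCoprime c (𝔣 0 * v.asIdeal)}) (m k : ℕ), absRestrictNormalHom (rayClassField K (𝔣 m * v.asIdeal ^ (k + 1))) (g c) =
          artinSymbol (galFrob K (rayClassField K (𝔣 m * v.asIdeal ^ (k + 1)))) c.1) (x : ∀ (_ : {c : Ideal (𝓞 K) // c ≠ ⊥ ∧ IsCoprime c (𝔣 0 * v.asIdeal)}) (m k : ℕ),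
        rayClassField K (𝔣 m * v.asIdeal ^ (k + 1))) (hx : ∀ (c : {c : Ideal (𝓞 K) // c ≠ ⊥ ∧ IsCoprime c (𝔣 0 * v.asIdeal)}) (m k : ℕ),
        IsThetaValueOne w₀.embedding (𝔣 m * v.asIdeal ^ (k + 1)) c.1 (algClosureEmb w₀.embedding ((x c m k : rayClassField K (𝔣 m * v.asIdeal ^ (k + 1))) : AlgebraicClosure K)))
      (_ : ∀ m n, ((rayAdicTower (𝔪 := 𝔣 m) (h𝔣0 m) v).U n).Normal) (_ : ∀ m n, ((absRayAdicTower (𝔪' := 𝔣 m) (h𝔣0 m) v).U n).Normal)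
      (μ : GroupDistribution (SubgroupTower.diagonal (fun m ↦ absRayAdicTower (𝔪' := 𝔣 m) (h𝔣0 m) v) (fun m n ↦ absRayAdicTower_U_anti (h𝔣0 m) (h𝔣0 (m + 1)) v (hle m) n)) ℂ_[2]),
      μ.bound = 1 → (∀ (c : {c : Ideal (𝓞 K) // c ≠ ⊥ ∧ IsCoprime c (𝔣 0 * v.asIdeal)}) (n : ℕ) (b : absoluteGaloisGroup K ⧸ (absRayAdicTower (𝔪' := 𝔣 n) (h𝔣0 n) v).U n),
        (twisting (g c) (Ideal.absNorm c.1 : ℂ_[2]) μ).μ n b = (GroupDistribution.induceFrom (Γ := absoluteGaloisGroup K)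
          (fun k ↦ rayAdicTower_U_eq_subgroupOf (𝔪 := 𝔣 n) (h𝔣0 n) v k) (fun b : GlobalNormCoherentUnits (h𝔣0 n) v ↦
            localMeasureFamily (h𝔣0 n) (hvm n) (hwm n) hq h2 u (E n) (hE n) hσ₀ hε θ hθ1 (j n) (hjC n) e₂ (ψ n) (hψ n)
              (RelNormCoherentUnits.ofGlobalUnits (h𝔣0 n) (hvm n) (hwm n) (isUniformizer_unit_mul h2 u) (hα0 n) (hα𝔣 n) (hαw n) (hαπ n) (E n) (hE n) (hdegE n) b))
          zero_le_one (fun _ ↦ le_rfl) (ellipticUnitsGlobal h24iii h25 hK w₀.embedding (h𝔣0 n) (h𝔣1 n) (hvm n) (hwm n) c.2.1 (isCoprime_chain 𝔣 𝔩 h𝔣succ hdiv c.2.2 n)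
            (x c n) (hx c n))).μ n b) → ∃ M₁ : ℕ, ∀ (k : ℕ) (w₁ : InfinitePlace K) (lam : HeckeCharacter K) (M : ℕ), M₁ ≤ M → 𝔣 k = modulusIdeal (insert vbar S) (fun _ ↦ M) →
          lam.HasInfinityType (fun _ ↦ 1) (fun _ ↦ 0) → lam.IsModulus (insert vbar S) (fun _ ↦ M) → modulusIdeal (insert vbar S) (fun _ ↦ M) ≠ ⊤ →
          (∀ uu : (𝓞 K)ˣ, (uu : 𝓞 K) - 1 ∈ modulusIdeal (insert vbar S) (fun _ ↦ M) → uu = 1) →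
          ∀ (χ : HeightOneSpectrum (𝓞 K) → ℂ), IsRayClassCharacter (modulusIdeal (insert vbar S) (fun _ ↦ M)) χ →
          ∀ (𝔠 : Ideal (𝓞 K)), 𝔠 ≠ ⊥ → IsCoprime 𝔠 (modulusIdeal (insert vbar S) (fun _ ↦ M)) → IsCoprime 𝔠 v.asIdeal →
          ∀ (εH : HeckeCharacter K) (eH : FramedGaloisRep K (PadicAlgCl 2) 1) (m : ℕ), IsPAdicAvatarOutside S ι εH eH → 3 ≤ m →
            εH.HasInfinityType (fun _ ↦ -(m : ℤ)) (fun _ ↦ 0) → (∀ w : HeightOneSpectrum (𝓞 K), w ∉ S → w ≠ vbar → εH.IsUnramifiedAt w) →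
            (SubgroupTower.diagonal (fun m ↦ absRayAdicTower (𝔪' := 𝔣 m) (h𝔣0 m) v)
                (fun m n ↦ absRayAdicTower_U_anti (h𝔣0 m) (h𝔣0 (m + 1)) v (hle m) n)).IsTowerContinuous (fun σ ↦ avatarValueAt eH σ) →
            (∀ w : HeightOneSpectrum (𝓞 K), ¬ modulusIdeal (insert vbar S) (fun _ ↦ M) ≤ w.asIdeal → εH.valueAtUniformizer w = (χ w)⁻¹ * (lam.valueAtUniformizer w ^ m)⁻¹) →
            ∀ hL : LFunction.HasEntireContinuation (heckeLFunction εH), ∀ I' : ℂ_[2], (12 : ℂ_[2]) * I' = Θε * (twisting τ 0 μ).integral (fun σ ↦ avatarValueAt eH σ) →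
            ∃ (T : Finset (Ideal (𝓞 K))) (L : Ideal (𝓞 K) → PeriodPair), IsRayClassReps (modulusIdeal (insert vbar S) (fun _ ↦ M)) T ∧ (∀ 𝔟 ∈ T, ∀ z : ℂ, z ∈ (L 𝔟).lattice ↔
                ∃ x ∈ ((modulusIdeal (insert vbar S) (fun _ ↦ M) : FractionalIdeal (𝓞 K)⁰ K) / (𝔟 : FractionalIdeal (𝓞 K)⁰ K)), z = Ω * w₁.embedding x) ∧
              (∀ 𝔟 ∈ T, ∀ z : ℂ, z ∈ (L (𝔠 * 𝔟)).lattice ↔ ∃ x ∈ ((modulusIdeal (insert vbar S) (fun _ ↦ M) : FractionalIdeal (𝓞 K)⁰ K) /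
                  ((𝔠 * 𝔟 : Ideal (𝓞 K)) : FractionalIdeal (𝓞 K)⁰ K)), z = Ω * w₁.embedding x) ∧ ((Ideal.absNorm 𝔠 : ℂ_[2]) -
                  ((ι.symm (idealPow K χ 𝔠 * idealPow K (fun w ↦ lam.valueAtUniformizer w) 𝔠 ^ m) : PadicAlgCl 2) : ℂ_[2])) * I' =
                ((ι.symm ((1 - (εH.valueAtUniformizer v)⁻¹ * (((2 : ℕ) : ℂ))⁻¹) * ∑ 𝔟 ∈ T, (idealPow K χ 𝔟)⁻¹ * (idealPow K (fun w ↦ lam.valueAtUniformizer w) 𝔟 ^ m)⁻¹ *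
                      ((Ideal.absNorm 𝔠 : ℂ) * (L 𝔟).eisensteinE m Ω - (L (𝔠 * 𝔟)).eisensteinE m Ω)) : PadicAlgCl 2) : ℂ_[2]) * ((Ωp : unrIntegers 2) : ℂ_[2]) ^ m :=
  P1_of_perUnitValues h24ii h24iii h25 (KatzMeasureJZeroSeam.perUnitValues_of_lane h15 h24ii h24iii h25)

set_option maxHeartbeats 1600000 in
/-- ★★★ **The SEAM stub's statement `hsupply`, from the prints alone** (`katzSeamSupply_two_of_perLevel ∘ P1_of_perUnitValues ∘
KatzMeasureJZeroSeam.perUnitValues_of_lane`).  GIVEN II.1.5 (15), II.2.4 (i)(ii)(iii), II.2.5 (i), II.2.7.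
[cite: deShalit1987, II.4.12 (p. 66–69), II.4.14 (36)–(40) (p. 71–73), II.4.16 (49)–(50) (p. 76–77)] -/
theorem katzSeamSupply_two_of_lane
    (h15 : DeShalit1987.prop15_grossencharacterReciprocity) (h24i : DeShalit1987.prop24_i_mem_rayClassField)
    (h24ii : DeShalit1987.prop24_ii_galoisAction) (h24iii : DeShalit1987.prop24_iii_unit) (h25 : DeShalit1987.prop25_i_normRelation)
    (h27 : DeShalit1987.prop27_power) :
    ∀ (K : Type) [Field K] [NumberField K], IsImaginaryQuadratic K → NumberField.classNumber K = 1 → ∀ (ι : PadicAlgCl 2 ≃+* ℂ) (v vbar : HeightOneSpectrum (𝓞 K)),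
        ((2 : ℕ) : 𝓞 K) ∈ v.asIdeal → ((2 : ℕ) : 𝓞 K) ∈ vbar.asIdeal → vbar ≠ v → (∀ (w : InfinitePlace K) (k : 𝓞 K), k ∈ v.asIdeal ↔ ‖ι.symm (w.embedding (k : K))‖ < 1) →
      ∃ (Ω : ℂ) (Ωp : (unrIntegers 2)ˣ), Ω ≠ 0 ∧ ∀ (S : Finset (HeightOneSpectrum (𝓞 K))), v ∉ S → vbar ∉ S →
          ∃ (𝒰 : SubgroupTower (absoluteGaloisGroup K)) (μ : GroupDistribution 𝒰 ℂ_[2]), (∀ n, IsOpen (𝒰.U n : Set (absoluteGaloisGroup K))) ∧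
            (⋂ n, (𝒰.U n : Set (absoluteGaloisGroup K))) ⊆ DeShalit1987.rayKer K 2 S ∧ μ.bound ≤ 1 ∧ ∃ M₁ : ℕ, ∀ (w₁ : InfinitePlace K) (lam : HeckeCharacter K) (M : ℕ), M₁ ≤ M →
              lam.HasInfinityType (fun _ ↦ 1) (fun _ ↦ 0) → lam.IsModulus (insert vbar S) (fun _ ↦ M) → modulusIdeal (insert vbar S) (fun _ ↦ M) ≠ ⊤ →
              (∀ uu : (𝓞 K)ˣ, (uu : 𝓞 K) - 1 ∈ modulusIdeal (insert vbar S) (fun _ ↦ M) → uu = 1) →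
              ∀ (χ : HeightOneSpectrum (𝓞 K) → ℂ), IsRayClassCharacter (modulusIdeal (insert vbar S) (fun _ ↦ M)) χ →
              ∀ (𝔠 : Ideal (𝓞 K)), 𝔠 ≠ ⊥ → IsCoprime 𝔠 (modulusIdeal (insert vbar S) (fun _ ↦ M)) → IsCoprime 𝔠 v.asIdeal →
              ∀ (εH : HeckeCharacter K) (eH : FramedGaloisRep K (PadicAlgCl 2) 1) (m : ℕ), IsPAdicAvatarOutside S ι εH eH → 3 ≤ m →
                εH.HasInfinityType (fun _ ↦ -(m : ℤ)) (fun _ ↦ 0) → (∀ w : HeightOneSpectrum (𝓞 K), w ∉ S → w ≠ vbar → εH.IsUnramifiedAt w) →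
                𝒰.IsTowerContinuous (fun σ ↦ avatarValueAt eH σ) → (∀ w : HeightOneSpectrum (𝓞 K), ¬ modulusIdeal (insert vbar S) (fun _ ↦ M) ≤ w.asIdeal →
                  εH.valueAtUniformizer w = (χ w)⁻¹ * (lam.valueAtUniformizer w ^ m)⁻¹) → ∀ hL : LFunction.HasEntireContinuation (heckeLFunction εH),
                ∃ (T : Finset (Ideal (𝓞 K))) (L : Ideal (𝓞 K) → PeriodPair), IsRayClassReps (modulusIdeal (insert vbar S) (fun _ ↦ M)) T ∧ (∀ 𝔟 ∈ T, ∀ z : ℂ, z ∈ (L 𝔟).lattice ↔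
                    ∃ x ∈ ((modulusIdeal (insert vbar S) (fun _ ↦ M) : FractionalIdeal (𝓞 K)⁰ K) / (𝔟 : FractionalIdeal (𝓞 K)⁰ K)), z = Ω * w₁.embedding x) ∧
                  (∀ 𝔟 ∈ T, ∀ z : ℂ, z ∈ (L (𝔠 * 𝔟)).lattice ↔ ∃ x ∈ ((modulusIdeal (insert vbar S) (fun _ ↦ M) : FractionalIdeal (𝓞 K)⁰ K) /
                      ((𝔠 * 𝔟 : Ideal (𝓞 K)) : FractionalIdeal (𝓞 K)⁰ K)), z = Ω * w₁.embedding x) ∧ ((Ideal.absNorm 𝔠 : ℂ_[2]) -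
                      ((ι.symm (idealPow K χ 𝔠 * idealPow K (fun w ↦ lam.valueAtUniformizer w) 𝔠 ^ m) : PadicAlgCl 2) : ℂ_[2])) * μ.integral (fun σ ↦ avatarValueAt eH σ) =
                    ((ι.symm ((1 - (εH.valueAtUniformizer v)⁻¹ * (((2 : ℕ) : ℂ))⁻¹) * ∑ 𝔟 ∈ T, (idealPow K χ 𝔟)⁻¹ * (idealPow K (fun w ↦ lam.valueAtUniformizer w) 𝔟 ^ m)⁻¹ *
                          ((Ideal.absNorm 𝔠 : ℂ) * (L 𝔟).eisensteinE m Ω - (L (𝔠 * 𝔟)).eisensteinE m Ω)) : PadicAlgCl 2) : ℂ_[2]) * ((Ωp : unrIntegers 2) : ℂ_[2]) ^ m :=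
  katzSeamSupply_two_of_perLevel h24i h24ii h24iii h25 h27 (P1_of_lane h15 h24ii h24iii h25)

set_option maxHeartbeats 1600000 in
/-- ★★★ **The R3 endpoint `KatzMeasureTwo.lMeasureJZero_classNumberOne_two` (VERBATIM), from the prints alone.**
GIVEN II.1.5 (15), II.2.4 (i)(ii)(iii), II.2.5 (i), II.2.7. [cite: deShalit1987, II.4.12 (p. 66–69), II.4.14 (36)–(40) (p. 71–73), II.4.16 (49)–(50) (p. 76–77)] -/
theorem lMeasureJZero_classNumberOne_two_of_lane
    (h15 : DeShalit1987.prop15_grossencharacterReciprocity) (h24i : DeShalit1987.prop24_i_mem_rayClassField)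
    (h24ii : DeShalit1987.prop24_ii_galoisAction) (h24iii : DeShalit1987.prop24_iii_unit) (h25 : DeShalit1987.prop25_i_normRelation)
    (h27 : DeShalit1987.prop27_power) :
    ∀ (K : Type) [Field K] [NumberField K], IsImaginaryQuadratic K → NumberField.classNumber K = 1 → ∀ (ι : PadicAlgCl 2 ≃+* ℂ) (v vbar : HeightOneSpectrum (𝓞 K)),
        ((2 : ℕ) : 𝓞 K) ∈ v.asIdeal → ((2 : ℕ) : 𝓞 K) ∈ vbar.asIdeal → vbar ≠ v → (∀ (w : InfinitePlace K) (k : 𝓞 K), k ∈ v.asIdeal ↔ ‖ι.symm (w.embedding (k : K))‖ < 1) →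
      ∃ (Ω δ : ℂ) (Ωp : (unrIntegers 2)ˣ), Ω ≠ 0 ∧ (δ ^ 2 = (NumberField.discr K : ℂ) ∨ δ ^ 2 = -(NumberField.discr K : ℂ)) ∧
        ∀ (S : Finset (HeightOneSpectrum (𝓞 K))), v ∉ S → vbar ∉ S → ∃ (𝒰 : SubgroupTower (absoluteGaloisGroup K)) (μ : GroupDistribution 𝒰 ℂ_[2]),
            (∀ n, IsOpen (𝒰.U n : Set (absoluteGaloisGroup K))) ∧ (⋂ n, (𝒰.U n : Set (absoluteGaloisGroup K))) ⊆ DeShalit1987.rayKer K 2 S ∧ μ.bound ≤ 1 ∧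
            ∀ (ε : HeckeCharacter K) (e : FramedGaloisRep K (PadicAlgCl 2) 1) (m : ℕ), IsPAdicAvatarOutside S ι ε e → 3 ≤ m →
              ε.HasInfinityType (fun _ ↦ -(m : ℤ)) (fun _ ↦ ((0 : ℕ) : ℤ)) → (∀ w : HeightOneSpectrum (𝓞 K), w ∉ S → w ≠ vbar → ε.IsUnramifiedAt w) →
              𝒰.IsTowerContinuous (fun σ ↦ avatarValueAt e σ) → ∀ hL : LFunction.HasEntireContinuation (heckeLFunction ε), μ.integral (fun σ ↦ avatarValueAt e σ) =
                  ((ι.symm (DeShalit1987.interpolationValue 2 v vbar S ε m 0 Ω δ (hL.continuation 0)) : PadicAlgCl 2) : ℂ_[2]) * ((Ωp : unrIntegers 2) : ℂ_[2]) ^ (m + 0) :=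
  lMeasureJZero_classNumberOne_two_of_perLevel h24i h24ii h24iii h25 h27 (P1_of_lane h15 h24ii h24iii h25)

end Summit.BirchSwinnertonDyer.BirchSwinnertonDyer.Theorems.PrintCf2.KatzMeasureJZeroTop

end
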